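import Literature.IUT.HodgeTheaters.GoodLocalFrobenioidOfGaloisUnitKummer
import Literature.IUT.HodgeTheaters.GoodLocalFrobenioidOfKitSplitTransport
import Literature.NumberTheory.LocalFields.EquivariantUnitRigidityNormed
import HarnessLib

/-!
# [IUTchI] Example 3.3 (iii) (e) AT THE GENUINE DATUM `k̄/K_v`, modulo the anabelian input (E2) only

Mochizuki, *Inter-universal Teichmüller theory I*, kurims manuscript (May 2020), Example 3.3 (iii) (e), p. 79
[claim: Mochizuki2012, status: disputed]: "(e) … one may reconstruct the split Frobenioids `F⊢_v`, `F^Θ_v`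
category-theoretically from `F̲_v`" (the preceding sentence citing [AbsTopIII], Proposition 3.2, (iii); Rmk. 3.3.2: `C_v` is
"essentially the same data as an MLF-Galois TM-pair of strictly Belyi type") — nothing of the series is asserted; no side
is taken on [IUTchIII] Cor. 3.12.

PROOF-ONLY file (abc-iut cell, seat abc-iut-L5-t16 gen 7; row E33iii/e, piece (F3d): the ASSEMBLY), no definitions, no new
`Prop`.  At the REAL bases `D_v = CosetCat Π_v ⊇ D⊢_v`, `Ω = k̄` the algebraic closure of a complete nonarchimedean field
`k = K_v` finite over `ℚ_p` (`GoodLocalFrobenioid.ofGalois (GaloisValDatum.ofComplete p k)`), ALL hypotheses of the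
generic files `…UnitTransport` / `…UnitRigidity` / `…UnitKummer` are discharged from the tree:
* (E1) Frobenioid side — [FrdI] Cor. 4.11 (iv) data of a self-equivalence `e` (abc-iut-w4-d109's
  `PadicFrd.exists_cor411iv_data_padic`, slim FSM base), abc-iut-L1's straightening of `e^Base` along a cofinal Galois
  tower (`BaseGaloisSystem.exists_mulEquiv_compatible_of_cosetCat_equivalence`) with the induced `φ` BICONTINUOUS
  (levels `φ(N_k) = N₂,k`), (INT) for the perfection datum, the ramification clause at the genuine datum
  (abc-iut-L5-t16's `hbaseRam_ofComplete`), the field functor read in `k̄` by the subfield inclusions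
  (`GaloisValDatum.fixedHom_apply_coe`), the archimedean property of the spectral norm;
* (E3) — abc-iut-w4-d014's Kummer rigidity `Literature.NumberTheory.LocalFields.map_algebraMap_eq_self_of_isAlgClosure_padic`;
* (E2) — REMAINS A HYPOTHESIS (`hE2`): every bicontinuous automorphism `φ` of `Π_v` is GEOMETRIC, i.e. covered by a
  valuation-preserving ring automorphism `σ` of `k̄` with `σ(aug(g)·x) = aug(φ g)·σ(x)` — print's anabelian input
  ([AbsTopIII] Thm. 1.9 / Cor. 1.10 for `X̲→_v` of strictly Belyi type; owner abc-iut-L4).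
RESULTS: `isPreservedBy_pSplitting_ofGalois_ofComplete` — every self-equivalence of the REAL `C_v` preserves `τ_{p_v}`
(the `hfix` of abc-iut-w4-d047's criterion); `splitFromF_ofGalois_ofComplete` — **clause (e) `SplitFromF` at the genuine
datum modulo (E2)** (with `hΔ` = [AbsAnab] Lem. 1.3.8 shape and slimness, as for clause (d)); and
`InitialThetaData.splitFromF_goodLocalFrobenioidOfEmb` — (e) AT THE PRINTED OBJECT of abc-iut-L5-t2's Def. 3.1 datum,
modulo (E2), with `hX`, density, `hΔC` (F-0004) and `hΔ` (F-0007) as for (d).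
Contrast: at the degenerate one-object base (e) FAILS (abc-iut-w4-d047's `not_splitFromF_ofKitQp`), so (E2) is load-bearing.
-/

noncomputable section

namespace Literature.IUT.HodgeTheaters

namespace GoodLocalFrobenioid

open CategoryTheory Opposite Function ValuativeRel Topology Filter Literature.AnabelianGeometry.SemiGraphs
open Literature.AlgebraicGeometry.Frobenioids Literature.AlgebraicGeometry.Frobenioids.PadicFrd
open Literature.AlgebraicGeometry.Frobenioids.BaseGaloisSystem

/-! ### The archimedean property and the Kummer rigidity (E3) at `Ω = k̄` -/

section OfComplete

variable (p : ℕ) [Fact p.Prime] (k : Type) [NontriviallyNormedField k] [CompleteSpace k] [IsUltrametricDist k]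
  [NormedAlgebra ℚ_[p] k] [FiniteDimensional ℚ_[p] k]

/-- Every element of `k̄` becomes an integer after multiplication by a power of `p` (the spectral norm is a rank-one
absolute value with `‖p‖ < 1`). [cite: NeukirchANT1999, Ch. II Thm. (4.8)] -/
theorem exists_valuation_pow_mul_le_one (x : (GaloisValDatum.ofComplete p k).Ω) :
    ∃ M : ℕ, valuation (GaloisValDatum.ofComplete p k).Ω
      (((p : ℕ) : (GaloisValDatum.ofComplete p k).Ω) ^ M * x) ≤ 1 := by
  -- the spectral norm of `k̄/k`, a multiplicative ring norm extending `‖·‖`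
  let f := spectralMulAlgNorm k (AlgebraicClosure k)
  have key : ∀ y : (GaloisValDatum.ofComplete p k).Ω, valuation (GaloisValDatum.ofComplete p k).Ω y ≤ 1 ↔ f y ≤ 1 := by
    intro y
    rw [← (valuation (GaloisValDatum.ofComplete p k).Ω).map_one, ← Valuation.Compatible.vle_iff_le]
    change spectralNorm k (AlgebraicClosure k) y ≤ spectralNorm k (AlgebraicClosure k) 1 ↔ _
    rw [spectralNorm_one]
    rfl
  by_cases hx : x = 0
  · exact ⟨0, by rw [hx, mul_zero, Valuation.map_zero]; exact zero_le⟩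
  have hp1 : f ((p : ℕ) : AlgebraicClosure k) < 1 := by
    change spectralNorm k (AlgebraicClosure k) ((p : ℕ) : AlgebraicClosure k) < 1
    rw [← map_natCast (algebraMap k (AlgebraicClosure k)) p, spectralNorm_extends]
    exact GaloisValDatum.norm_p_lt_one p k
  have hx' : 0 < f x := lt_of_le_of_ne (apply_nonneg f x) (fun h => hx ((map_eq_zero_iff_eq_zero f).mp h.symm))
  obtain ⟨M, hM⟩ := exists_pow_lt_of_lt_one (inv_pos.mpr hx') hp1
  refine ⟨M, (key _).mpr ?_⟩
  have h2 : f ((((p : ℕ) : AlgebraicClosure k)) ^ M * (show AlgebraicClosure k from x)) ≤ 1 := by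
    rw [map_mul, map_pow]
    have h := mul_lt_mul_of_pos_right hM hx'
    rw [inv_mul_cancel₀ hx'.ne'] at h
    exact h.le
  exact h2

include p in
/-- **(E3) at `k̄/k`** (abc-iut-w4-d014's Kummer rigidity, `map_algebraMap_eq_self_of_isAlgClosure_padic`, read for the
spectral valuation of `k̄`): every `Gal(k̄/k)`-equivariant valuation-preserving multiplicative `C : k̄ →*₀ k̄` fixes `k`
pointwise. [cite: NeukirchANT1999, Ch. II Prop. 5.7] -/
theorem map_algebraMap_eq_self_closure (C : AlgebraicClosure k →*₀ AlgebraicClosure k)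
    (hC : ∀ (τ : AlgebraicClosure k ≃ₐ[k] AlgebraicClosure k) (x : AlgebraicClosure k), C (τ x) = τ (C x))
    (hv : ∀ x, @ValuativeRel.valuation _ _ (GaloisValDatum.closureVal k) (C x) =
      @ValuativeRel.valuation _ _ (GaloisValDatum.closureVal k) x)
    (a : k) : C (algebraMap k (AlgebraicClosure k) a) = algebraMap k (AlgebraicClosure k) a := by
  letI := GaloisValDatum.closureVal k
  refine Literature.NumberTheory.LocalFields.map_algebraMap_eq_self_of_isAlgClosure_padic p
    (ValuativeRel.valuation (AlgebraicClosure k)) (fun c c' => ?_) C hC hv a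
  rw [← Valuation.Compatible.vle_iff_le, GaloisValDatum.closureVal_iff, spectralNorm_extends, spectralNorm_extends]

/-- The same, phrased for the datum `GaloisValDatum.ofComplete p k` (`Ω = k̄`, `Gal = Gal(k̄/k)`).
[cite: NeukirchANT1999, Ch. II Prop. 5.7] -/
theorem map_algebraMap_eq_self_ofComplete (C : (GaloisValDatum.ofComplete p k).Ω →*₀ (GaloisValDatum.ofComplete p k).Ω)
    (hC : ∀ (τ : (GaloisValDatum.ofComplete p k).Gal) (x : (GaloisValDatum.ofComplete p k).Ω), C (τ x) = τ (C x))
    (hv : ∀ x, valuation (GaloisValDatum.ofComplete p k).Ω (C x) = valuation (GaloisValDatum.ofComplete p k).Ω x)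
    (a : (GaloisValDatum.ofComplete p k).k) :
    C (algebraMap (GaloisValDatum.ofComplete p k).k (GaloisValDatum.ofComplete p k).Ω a) =
      algebraMap (GaloisValDatum.ofComplete p k).k (GaloisValDatum.ofComplete p k).Ω a :=
  map_algebraMap_eq_self_closure p k C hC hv a

end OfComplete

/-! ### (e) at the genuine datum: every self-equivalence of the REAL `C_v` preserves `τ_{p_v}`, modulo (E2) -/

section Genuine

variable (p : ℕ) [Fact p.Prime] (k : Type) [NontriviallyNormedField k] [CompleteSpace k] [IsUltrametricDist k]
  [NormedAlgebra ℚ_[p] k] [FiniteDimensional ℚ_[p] k] {P : Type} [Group P] [TopologicalSpace P]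
  (aug : P →* (GaloisValDatum.ofComplete p k).Gal) (hc : Continuous aug) (hs : Surjective aug) (ho : IsOpenMap aug)
  (Kv : Type) [Field Kv] [ValuativeRel Kv] (hp : ((p : Kv)) ∈ PadicFrd.intNonzero Kv)

/-- **[IUTchI] Ex. 3.3 (iii) (e), the characteristic splitting, AT THE GENUINE DATUM `k̄/K_v`, modulo (E2).**  For `Π_v`
profinite-tempered and second countable over `G_v = Gal(k̄/k)` with `hΔ` ([AbsAnab] Lem. 1.3.8 shape) and `𝓑(Π_v)⁰` slim, and
GIVEN (E2) — every bicontinuous automorphism of `Π_v` is geometric (`hE2`, [AbsTopIII] Thm. 1.9 / Cor. 1.10, the anabelian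
input of the sentence preceding print's (e), p. 79 l. 52–53: "the Kummer map of [AbsTopIII], Proposition 3.2, (iii)") — every
self-equivalence `e` of the REAL `p_v`-adic Frobenioid `C_v` carries `τ_{p_v}(A)` onto `τ_{p_v}(e A)` for every object `A` ((E1) =
the tree's Frobenioid theory, (E3) = Kummer rigidity,
both discharged). ([IUTchI] Ex 3.3 (iii) (e) p.79) [claim: Mochizuki2012, status: disputed] -/
theorem isPreservedBy_pSplitting_ofGalois_ofComplete [IsTopologicalGroup P] [SecondCountableTopology P]
    (hP : IsTempered P) (hΔ : ∀ φ : P ≃ₜ* P, aug.ker.map φ.toMulEquiv.toMonoidHom = aug.ker) (hsl : IsSlim (CosetCat P))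
    (hE2 : ∀ φ : P ≃ₜ* P, ∃ σ : (GaloisValDatum.ofComplete p k).Ω ≃+* (GaloisValDatum.ofComplete p k).Ω,
      (∀ x, valuation (GaloisValDatum.ofComplete p k).Ω (σ x) = valuation (GaloisValDatum.ofComplete p k).Ω x) ∧
        ∀ (g : P) (x : (GaloisValDatum.ofComplete p k).Ω), σ ((aug g) x) = (aug (φ g)) (σ x))
    (e : (ofGalois (GaloisValDatum.ofComplete p k) aug hc hs ho Kv hp).Cv ≌
      (ofGalois (GaloisValDatum.ofComplete p k) aug hc hs ho Kv hp).Cv) :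
    S3Local.CharSplitting.IsPreservedBy
      ⟨(Datum.perf (CosetCat.push aug ho ⋙ (GaloisValDatum.ofComplete p k).fieldFunctor)
          (hlocOver (CosetCat.push aug ho) (GaloisValDatum.ofComplete p k).fieldFunctor
            (GaloisValDatum.ofComplete p k).fieldFunctor_isPadicLocal)
          CosetCat.isConnected CosetCat.isTotallyEpimorphic).pSplittingSubmonoid⟩
      ⟨(Datum.perf (CosetCat.push aug ho ⋙ (GaloisValDatum.ofComplete p k).fieldFunctor)
          (hlocOver (CosetCat.push aug ho) (GaloisValDatum.ofComplete p k).fieldFunctor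
            (GaloisValDatum.ofComplete p k).fieldFunctor_isPadicLocal)
          CosetCat.isConnected CosetCat.isTotallyEpimorphic).pSplittingSubmonoid⟩ e.functor := by
  intro A
  -- notation
  let d := GaloisValDatum.ofComplete p k
  let Q : Datum (CosetCat P) p := Datum.perf (CosetCat.push aug ho ⋙ d.fieldFunctor)
    (hlocOver (CosetCat.push aug ho) d.fieldFunctor d.fieldFunctor_isPadicLocal) CosetCat.isConnected
    CosetCat.isTotallyEpimorphic
  have hD : IsOfFSMType (CosetCat P) := CosetCat.isOfFSMType
  -- (E1) the [FrdI] Cor. 4.11 (iv) data of `e`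
  obtain ⟨ΨBase, -, η, hequiv, hdeg, -, -⟩ := PadicFrd.exists_cor411iv_data_padic Q Q hD hD hsl hsl e
  haveI := hequiv
  -- (E1) the straightening of `e^Base` along a cofinal Galois tower
  obtain ⟨N, hN, hNb⟩ := exists_antitone_cofinal_seq hP
  obtain ⟨N₂, hN₂, hN₂b, ι, φ, hφ⟩ :=
    exists_mulEquiv_compatible_of_cosetCat_equivalence hP hP N hN ΨBase.asEquivalence hNb
  let j : ∀ n : ℕ, cQ (N₂ n) ≅ ΨBase.obj (cQ (N n)) := fun n => (ι.app n).unop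
  have hcomm : ∀ (n : ℕ) (g : P), crightMul (N₂ n) (φ g) ≫ (j n).hom = (j n).hom ≫ ΨBase.map (crightMul (N n) g) := by
    intro n g
    have h := congrArg (fun α : Aut (cosetSystem N₂ hN₂) => (α.hom.app n).unop) (hφ g)
    simp only [toAutCoset_hom_app, Iso.conjAut_hom, Iso.conj_apply, NatTrans.comp_app, unop_comp,
      Category.assoc] at h
    change crightMul (N₂ n) (φ g) = (j n).hom ≫ ΨBase.map (crightMul (N n) g) ≫ (j n).inv at h
    rw [h, Category.assoc, Category.assoc, Iso.inv_hom_id, Category.comp_id]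
  have hj : ∀ ⦃n n' : ℕ⦄ (h : n ≤ n'), (j n').hom ≫ ΨBase.map (cproj (hN h)) = cproj (hN₂ h) ≫ (j n).hom := by
    intro n n' h
    have hnat := congrArg Quiver.Hom.unop (ι.hom.naturality (homOfLE h))
    simp only [Functor.comp_map, Functor.op_map, cosetSystem_map, unop_comp] at hnat
    exact hnat
  -- `φ(N_n) = N₂,n`, hence `φ` is bicontinuous
  have hlevel : ∀ (n : ℕ) (g : P), φ g ∈ N₂ n ↔ g ∈ N n := by
    intro n g
    rw [← crightMul_eq_id_iff, ← crightMul_eq_id_iff]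
    constructor
    · intro h
      have h2 := hcomm n g
      rw [h, Category.id_comp] at h2
      have h3 : ΨBase.map (crightMul (N n) g) = 𝟙 _ :=
        (cancel_epi (j n).hom).1 (by rw [← h2, Category.comp_id])
      exact ΨBase.map_injective (by rw [h3, CategoryTheory.Functor.map_id])
    · intro h
      have h2 := hcomm n g
      rw [h, CategoryTheory.Functor.map_id, Category.comp_id] at h2
      exact (cancel_mono (j n).hom).1 (by rw [h2, Category.id_comp])
  have hcont : Continuous φ := by
    refine continuous_of_continuousAt_one φ ?_
    rw [ContinuousAt, map_one]
    intro U hU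
    obtain ⟨n, hn⟩ := hN₂b U hU
    exact Filter.mem_map.mpr
      (Filter.mem_of_superset ((N n).toOpenSubgroup.mem_nhds_one) fun g hg => hn ((hlevel n g).2 hg))
  have hcont' : Continuous φ.symm := by
    refine continuous_of_continuousAt_one φ.symm ?_
    rw [ContinuousAt, map_one]
    intro U hU
    obtain ⟨n, hn⟩ := hNb U hU
    refine Filter.mem_map.mpr (Filter.mem_of_superset ((N₂ n).toOpenSubgroup.mem_nhds_one) fun g hg => hn ?_)
    exact (hlevel n (φ.symm g)).1 (by rwa [MulEquiv.apply_symm_apply])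
  let φc : P ≃ₜ* P := { φ with continuous_toFun := hcont, continuous_invFun := hcont' }
  -- (E2) for `φ`
  obtain ⟨σ, hσv, hσ⟩ := hE2 φc
  -- the field functor read in `k̄`
  let ε : ∀ B : CosetCat P, Q.fld B →+* d.Ω := fun B =>
    (IntermediateField.val (d.fixedFld ((CosetCat.push aug ho).obj B))).toRingHom
  have hεi : ∀ B, Injective (ε B) := fun B a b h => Subtype.ext h
  have hε : ∀ ⦃B B' : CosetCat P⦄ (f : B ⟶ B') (g : P), CosetCat.pt f = ((g : P) : B'.carrier) →
      ∀ y : Q.fld B', ε B ((Q.base.map f).alg y) = (aug g) (ε B' y) := by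
    intro B B' f g hg y
    exact d.fixedHom_apply_coe ((CosetCat.push aug ho).map f) (aug g)
      (by rw [CosetCat.pt_push_map, hg, CosetCat.pushQuot_coe]) y
  have hεle : ∀ (B : CosetCat P) (a b : Q.fld B), ε B a ≤ᵥ ε B b ↔ a ≤ᵥ b := fun B a b => (d.valOn_iff _ a b).symm
  have hεs : ∀ (B : CosetCat P) (x : d.Ω), (∀ u ∈ B.sg, (aug u) x = x) → ∃ y : Q.fld B, ε B y = x := by
    intro B x hx
    refine ⟨⟨x, (IntermediateField.mem_fixedField_iff _ _).mpr ?_⟩, rfl⟩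
    rintro γ ⟨u, hu, rfl⟩
    exact hx u hu
  -- (INT), the ramification clause, the archimedean property, (E3)
  have hint : ∀ (B : CosetCat P) (a : OrdInt (Q.fld B)), ∃ x : Q.Φ.obj (op B), Q.ιHom B x = Realification.of _ a :=
    Datum.perf_exists_ιHom_eq _ _ _ _
  have hram := fun X => hram_ofGalois_of_base d aug hc hs ho Kv hp hsl (hbaseRam_ofComplete p k aug hc hs ho hP hΔ) e X
  -- the generic theorem
  exact UnitTransport.map_pSplittingSubmonoid_eq_of_geometric d aug Q ε hεi hε e ΨBase η (fun _ _ ψ => hdeg ψ)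
    (fun X => η.inv.app X) (fun _ _ lam => UnitTransport.eta_inv_naturality Q e ΨBase η lam) N N₂ hN hN₂ (fun n => (j n).hom) hj φ hcomm hc hs
    hNb hεle hεs hint hD hsl hram (exists_valuation_pow_mul_le_one p k) ⟨σ, hσv, hσ⟩
    (map_algebraMap_eq_self_ofComplete p k) A

/-- **[IUTchI] Ex. 3.3 (iii) (e) `SplitFromF` AT THE GENUINE DATUM `k̄/K_v`, modulo (E2)**: every self-equivalence of
`F̲_v = C_v` lifts to a `τ⊢_v`-preserving self-equivalence of `C⊢_v` and, through `F⊢_v ⥲ F^Θ_v`, to a `τ^Θ_v`-preserving one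
of `C^Θ_v` — abc-iut-w4-d047's criterion (`splitFromF_ofGalois_ofComplete_of_isPreservedBy`: clause (d), proved at the
genuine datum, + kit transport) fed with `isPreservedBy_pSplitting_ofGalois_ofComplete`.  Inputs: `hΔ` ([AbsAnab] Lem.
1.3.8 shape), slimness, and the anabelian input (E2) ONLY. ([IUTchI] Ex 3.3 (iii) (e) p.79) [claim: Mochizuki2012, status: disputed] -/
theorem splitFromF_ofGalois_ofComplete [IsTopologicalGroup P] [SecondCountableTopology P]
    (hP : IsTempered P) (hΔ : ∀ φ : P ≃ₜ* P, aug.ker.map φ.toMulEquiv.toMonoidHom = aug.ker) (hsl : IsSlim (CosetCat P))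
    (hE2 : ∀ φ : P ≃ₜ* P, ∃ σ : (GaloisValDatum.ofComplete p k).Ω ≃+* (GaloisValDatum.ofComplete p k).Ω,
      (∀ x, valuation (GaloisValDatum.ofComplete p k).Ω (σ x) = valuation (GaloisValDatum.ofComplete p k).Ω x) ∧
        ∀ (g : P) (x : (GaloisValDatum.ofComplete p k).Ω), σ ((aug g) x) = (aug (φ g)) (σ x)) :
    (ofGalois (GaloisValDatum.ofComplete p k) aug hc hs ho Kv hp).SplitFromF :=
  splitFromF_ofGalois_ofComplete_of_isPreservedBy p Kv hp k aug hc hs ho hP hΔ hsl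
    (fun e => isPreservedBy_pSplitting_ofGalois_ofComplete p k aug hc hs ho Kv hp hP hΔ hsl hE2 e)

end Genuine

end GoodLocalFrobenioid

/-! ### At the printed object: the initial Θ-datum at `v̲ ∈ V̲^good ∩ V̲^non`, `K_v̲ = k` -/

section Datum

open CategoryTheory Literature.AnabelianGeometry.SemiGraphs Literature.AlgebraicGeometry.Frobenioids
open Literature.AlgebraicGeometry.Frobenioids.PadicFrd Literature.AnabelianGeometry.AbsoluteAnabelian ValuativeRel

universe v w

variable {F : Type v} {K : Type w} {Fbar : Type} [Field F] [NumberField F] [Field K] [NumberField K]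
  [Algebra F K] [Field Fbar] [Algebra F Fbar] [Algebra K Fbar] [IsScalarTower F K Fbar] [Normal K Fbar]
  {E : WeierstrassCurve F} [E.IsElliptic] {l : ℕ} {Pb : BadPlacePredicates K}
  (D : InitialThetaData F K Fbar E l Pb) (p : ℕ) [Fact p.Prime]
  (k : Type) [NontriviallyNormedField k] [CompleteSpace k] [IsUltrametricDist k] [NormedAlgebra ℚ_[p] k]
  [FiniteDimensional ℚ_[p] k] [Algebra K k]

namespace InitialThetaData

/-- **[IUTchI] Ex. 3.3 (iii) (e) AT THE PRINTED OBJECT, modulo the anabelian input (E2) only.**  For abc-iut-L5-t2's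
Def. 3.1 datum `D` at `v̲ ∈ V̲^good ∩ V̲^non`, `K_v̲ = k`, `Π_v̲ := Π_{X̲→_K} ×_{G_K} Gal(k̄/k)` along `ι : F̄ → k̄`: GIVEN the
openness `hX` (Def. 3.1 (f)), the density of `K` in `k`, the named anabelian inputs `hΔC` ([AbsAnab] Lem. 1.3.1, FACT
F-0004) and `hΔ` ([AbsAnab] Lem. 1.3.8, FACT F-0007), and (E2) `hE2` (every bicontinuous automorphism of `Π_v̲` is geometric:
[AbsTopIII] Thm. 1.9 / Cor. 1.10 for `X̲→_v̲` of strictly Belyi type — the input of print's "[AbsTopIII], Proposition 3.2, (iii)", p. 79 l. 52–53),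
the split Frobenioids `F⊢_v̲`, `F^Θ_v̲` are reconstructible from `F̲_v̲ = C_v̲` (`SplitFromF`): (E1) and the Kummer rigidity
(E3) are DISCHARGED. ([IUTchI] Ex 3.3 (iii) (e) p.79) [claim: Mochizuki2012, status: disputed] -/
theorem splitFromF_goodLocalFrobenioidOfEmb [SecondCountableTopology D.PiC]
    (ι : Fbar →ₐ[K] AlgebraicClosure k) (hX : IsOpen (D.PiXarrow : Set D.PiC)) (hd : DenseRange (algebraMap K k))
    (hΔC : IsSlimGroup D.DeltaC)
    (hΔ : ∀ φ : D.PiLoc D.PiXarrow (localToGF F k ι) ≃ₜ* D.PiLoc D.PiXarrow (localToGF F k ι),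
      (D.augLoc D.PiXarrow (localToGF F k ι)).ker.map φ.toMulEquiv.toMonoidHom =
        (D.augLoc D.PiXarrow (localToGF F k ι)).ker)
    (hE2 : ∀ φ : D.PiLoc D.PiXarrow (localToGF F k ι) ≃ₜ* D.PiLoc D.PiXarrow (localToGF F k ι),
      ∃ σ : (GaloisValDatum.ofComplete p k).Ω ≃+* (GaloisValDatum.ofComplete p k).Ω,
        (∀ x, valuation (GaloisValDatum.ofComplete p k).Ω (σ x) = valuation (GaloisValDatum.ofComplete p k).Ω x) ∧
          ∀ (g : D.PiLoc D.PiXarrow (localToGF F k ι)) (x : (GaloisValDatum.ofComplete p k).Ω),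
            σ ((D.augLoc D.PiXarrow (localToGF F k ι) g) x) = (D.augLoc D.PiXarrow (localToGF F k ι) (φ g)) (σ x)) :
    @GoodLocalFrobenioid.SplitFromF p k _ (GaloisValDatum.normVal k) (D.goodLocalFrobenioidOfEmb p k ι hX) := by
  letI := GaloisValDatum.normVal k
  haveI := GaloisValDatum.charZero p k
  haveI : CompactSpace (D.PiLoc D.PiXarrow (localToGF F k ι)) :=
    D.compactSpace_PiLoc D.PiXarrow (localToGF F k ι) hX (continuous_localToGF F k ι)
  haveI := D.secondCountableTopology_galLoc p k ι hd
  haveI : SecondCountableTopology (D.PiLoc D.PiXarrow (localToGF F k ι)) :=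
    (inferInstance : SecondCountableTopology
      ((D.PiLoc D.PiXarrow (localToGF F k ι) : Set (D.PiC × (AlgebraicClosure k ≃ₐ[k] AlgebraicClosure k)))))
  exact D.splitFromF_goodLocalFrobenioidOfEmb_of_isPreservedBy p k ι hX hd hΔC hΔ fun e =>
    GoodLocalFrobenioid.isPreservedBy_pSplitting_ofGalois_ofComplete p k (D.augLoc D.PiXarrow (localToGF F k ι))
      (D.continuous_augLoc D.PiXarrow (localToGF F k ι)) (D.augLoc_PiXarrow_surjective k ι)
      (D.isOpenMap_augLoc D.PiXarrow (localToGF F k ι) hX (continuous_localToGF F k ι)) k (GaloisValDatum.p_mem_normVal p k)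
      IsTempered.of_profinite hΔ
      (PadicFrd.isSlim_cosetCat_of_isSlimGroup (D.isSlimGroup_PiLoc_PiXarrow_of_geom_slim p k hΔC ι hX)) hE2 e

end InitialThetaData

end Datum

end Literature.IUT.HodgeTheaters

end
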